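import Mathlib
import Literature.Computability.AlgebraicComplexity.ArithCircuitProofs
import Summits.ValiantsHypothesis.ValiantsHypothesis.Theorems.DivisionGapPerDivisionHardStubJssContraction

/-!
# Crux `DivisionGap.PerCofactorDegreeReduction` (stmt-ValiantsHypothesis-15046), line `Sketch` —
# stub `stub_monomialStripping`: monomial content is polynomially free, independently of its degree

**Theorem (`stub_monomialStripping`).** Over the semiring `ℝ≥0`, in the `n × n` variables `x_ij`
and the tree's fan-in-two circuit size `complexity` (`L`): there is an absolute constant `c`
(here `c = 16`) with `L(q) ≤ c (n + 1)^c (L(x^D · q) + 1)^c` for every exponent vector `D` and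
every `q` — stripping a monomial factor costs polynomially in `n` and `s = L(x^D q)`, INDEPENDENTLY
of `deg x^D` (which may be `2^s`).  This is Jukna–Seiwert–Sergeev 2022 (ECCC TR20-178), Thm 1 /
Lemma 2 ("reciprocal inputs gain at most quadratically"), in the form
`L(q) ≤ 16 ((n + 1)(s + 1))²` (`complexity_le_of_monomial_mul`).

## Proof (the JSS contraction, already in the tree)

The sibling crux `DivisionGap.PerDivisionHard` landed the full gate-by-gate contraction
(`Theorems/DivisionGapPerDivisionHardStubJssContraction{A,B,}.lean`, helper namespace
`JssContraction`): for a fan-in-two circuit `P` of size `s < T` over `ℝ≥0` and an exponent vector `e`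
with entries `< 2^T` there is a fan-in-two circuit of size `kSize σ T · s + mSize σ T + 1` computing
`x^e · contract (P.eval)` (`exists_circuit_monomial_mul_contract`), where
`contract p = p / x^{gcdVec p}` strips the gcd monomial of the support; `contract (x^D q) = contract q`
(`contract_monomial_mul`), `q = x^{gcdVec q} · contract q` (`monomial_gcdVec_mul_contract`), and the
entries of `gcdVec q` are `≤ deg (x^D q) ≤ 2^s` (`gcdVec_apply_le_totalDegree_monomial_mul`,
`totalDegree_operand_eval_le`).  Applied to a size-minimal `P` for `x^D q` with `T = s + 1` and
`e = gcdVec q` this computes `q` with `kSize σ (s+1) · s + mSize σ (s+1) + 1` gates, and for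
`σ = Fin n × Fin n` this is `(2n²(2s+3) + 5) s + n²(2s+3) + 2 ≤ 16 (n+1)² (s+1)²` (`size_le_sixteen`).
The registered form follows from `X² ≤ X^16` for `X = (n+1)(s+1) ≥ 1`.

Leans on the tree only: `JssContraction.*` (sibling crux, accepted), `ArithCircuitProofs`
(`exists_computes_size_eq_complexity`, `complexity_le_size`).  No definitions.
-/

noncomputable section

-- `Summit.ValiantsHypothesis.ValiantsHypothesis.…` is the tree's mandated single-conjunct layout
-- (Problem = Summit), so the duplicated namespace component is intended.
set_option linter.dupNamespace false

namespace Summit.ValiantsHypothesis.ValiantsHypothesis.Theorems.DivisionGap.PerCofactorDegreeReduction.MonomialStripping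

open MvPolynomial Literature.Computability.AlgebraicComplexity ArithCircuit
open Summit.ValiantsHypothesis.ValiantsHypothesis.Theorems.DivisionGapPerDivisionHard.JssContraction
open scoped NNReal

/-! ### Size arithmetic -/

/-- The block sizes of the JSS contraction for `σ = Fin n × Fin n`, `T = s + 1`:
`kSize · s + mSize + 1 ≤ kSize · (s + 1) ≤ 16 (n + 1)² (s + 1) · (s + 1)`. [folklore] -/
theorem size_le_sixteen (n s : ℕ) :
    kSize (Fin n × Fin n) (s + 1) * s + mSize (Fin n × Fin n) (s + 1) + 1 ≤
      16 * ((n + 1) * (s + 1)) ^ 2 := by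
  have hk : kSize (Fin n × Fin n) (s + 1) = 2 * (n * n * (2 * (s + 1) + 1)) + 5 := by
    simp only [kSize, kPred, mSize, mPred, Fintype.card_prod, Fintype.card_fin]; ring
  have hm : mSize (Fin n × Fin n) (s + 1) = n * n * (2 * (s + 1) + 1) + 1 := by
    simp only [mSize, mPred, Fintype.card_prod, Fintype.card_fin]
  rw [hk, hm]
  have h1 : n * n * (2 * (s + 1) + 1) ≤ 3 * ((n + 1) * (n + 1) * (s + 1)) := by
    calc n * n * (2 * (s + 1) + 1) ≤ (n + 1) * (n + 1) * (3 * (s + 1)) :=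
          Nat.mul_le_mul (Nat.mul_le_mul (Nat.le_succ n) (Nat.le_succ n)) (by omega)
      _ = 3 * ((n + 1) * (n + 1) * (s + 1)) := by ring
  set m := n * n * (2 * (s + 1) + 1) with hm_def
  set Z := (n + 1) * (n + 1) * (s + 1) with hZ
  have hZ1 : 1 ≤ Z := by
    rw [hZ]; exact Nat.mul_pos (Nat.mul_pos (Nat.succ_pos n) (Nat.succ_pos n)) (Nat.succ_pos s)
  have h2 : (2 * m + 5) * s + (m + 1) + 1 ≤ (2 * m + 5) * (s + 1) := by nlinarith
  have h3 : 2 * m + 5 ≤ 11 * Z := by omega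
  calc (2 * m + 5) * s + (m + 1) + 1 ≤ (2 * m + 5) * (s + 1) := h2
    _ ≤ 11 * Z * (s + 1) := Nat.mul_le_mul_right _ h3
    _ ≤ 16 * Z * (s + 1) := Nat.mul_le_mul_right _ (Nat.mul_le_mul_right _ (by norm_num))
    _ = 16 * ((n + 1) * (s + 1)) ^ 2 := by rw [hZ]; ring

/-! ### The explicit quadratic bound -/

/-- **Monomial content is polynomially free (Jukna–Seiwert–Sergeev 2022, Thm 1 / Lemma 2, in the
tree's weighted fan-in-two model over `ℝ≥0`), explicit form.**  If `x^D · q` has a fan-in-two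
circuit of size `s` over `ℝ≥0` in the `n²` variables `x_ij`, then `q` has one of size
`≤ 16 ((n + 1)(s + 1))²`, whatever the degree of `x^D`: contract a size-minimal circuit for
`x^D q` gate by gate (`JssContraction.exists_circuit_monomial_mul_contract` of the sibling crux
`DivisionGap.PerDivisionHard`) and finish with `q = x^{gcdVec q} · contract (x^D q)`.
[cite: JuknaSeiwertSergeev2022, Thm 1] -/
theorem complexity_le_of_monomial_mul (n : ℕ) (D : (Fin n × Fin n) →₀ ℕ)
    (q : MvPolynomial (Fin n × Fin n) ℝ≥0) :
    complexity q ≤ 16 * ((n + 1) * (complexity (monomial D (1 : ℝ≥0) * q) + 1)) ^ 2 := by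
  -- adapted from `DivisionGapPerDivisionHard.stub_jssContraction` (same tree, sibling crux)
  obtain ⟨P, h2, hP, hs⟩ := exists_computes_size_eq_complexity (monomial D (1 : ℝ≥0) * q)
  rw [← hs]
  have hPe : P.eval = monomial D 1 * q := hP
  -- the entries of `gcdVec q` are `2^s`-bounded
  have he : ∀ v, gcdVec q v < 2 ^ (P.size + 1) := fun v => by
    refine lt_of_le_of_lt ((gcdVec_apply_le_totalDegree_monomial_mul D q v).trans ?_)
      (Nat.pow_lt_pow_right (by norm_num) (Nat.lt_succ_self _))
    rw [← hPe]
    exact totalDegree_operand_eval_le P.gates h2 P.output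
  -- the contracted circuit, times `x^{gcdVec q}`, computes `q`
  obtain ⟨Q, hQ2, hQs, hQe⟩ :=
    exists_circuit_monomial_mul_contract h2 (Nat.lt_succ_self P.size) he
  have hQ : Q.Computes q := by
    show Q.eval = q
    rw [hQe, hPe, contract_monomial_mul, monomial_gcdVec_mul_contract]
  refine (complexity_le_size hQ2 hQ).trans ?_
  rw [hQs]
  exact size_le_sixteen n P.size

/-! ### The stub -/

/-- **stub_monomialStripping — MONOMIAL CONTENT IS (POLYNOMIALLY) FREE, DEGREE-FREE
(Jukna–Seiwert–Sergeev 2022 = ECCC TR20-178, Thm 1 / Lemma 2: reciprocal inputs gain at most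
quadratically).**  Over `ℝ≥0`, if `x^D · q` has a fan-in-two circuit of size `s` in the `n²`
variables `x_ij` then `q` has one of size `≤ c (n + 1)^c (s + 1)^c` with the absolute constant
`c = 16`, independently of `deg x^D ≤ 2^s` (`complexity_le_of_monomial_mul`:
`L(q) ≤ 16 ((n+1)(s+1))² ≤ 16 (n+1)^16 (s+1)^16`). [cite: JuknaSeiwertSergeev2022, Thm 1] -/
theorem stub_monomialStripping :
    ∃ c : ℕ, ∀ (n : ℕ) (D : (Fin n × Fin n) →₀ ℕ) (q : MvPolynomial (Fin n × Fin n) ℝ≥0),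
      complexity q ≤ c * (n + 1) ^ c * (complexity (monomial D 1 * q) + 1) ^ c := by
  refine ⟨16, fun n D q => (complexity_le_of_monomial_mul n D q).trans ?_⟩
  set s := complexity (monomial D (1 : ℝ≥0) * q)
  have hn : (n + 1) ^ 2 ≤ (n + 1) ^ 16 := Nat.pow_le_pow_right (Nat.succ_pos n) (by norm_num)
  have hs : (s + 1) ^ 2 ≤ (s + 1) ^ 16 := Nat.pow_le_pow_right (Nat.succ_pos s) (by norm_num)
  calc 16 * ((n + 1) * (s + 1)) ^ 2 = 16 * (n + 1) ^ 2 * (s + 1) ^ 2 := by ring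
    _ ≤ 16 * (n + 1) ^ 16 * (s + 1) ^ 16 := by gcongr

end Summit.ValiantsHypothesis.ValiantsHypothesis.Theorems.DivisionGap.PerCofactorDegreeReduction.MonomialStripping

end
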